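import Mathlib
import HarnessLib
import Summits.HubbardSuperconductivity.HubbardSuperconductivity.Theorems.KLProgrammeC4aCausticWindowCover

/-!
# Route `KLProgramme` — crux C4a, S3 brick (B4) «(B4)-UMK1», «(M4)-COVER» part 6: the NEAR-CAUSTIC LOCUS of a ϑ-tile on one sheet is ONE short loop arc —
# two near-caustic configurations of the same sheet have loop angles within `(π/(2u_min))(τ₀ + msD₁|ϑ₁ − ϑ₂|/2)` on the torus

Cell `gate-hubbard-kl`, seat hubbard-kl-k3c3-p3 (g30; row «implicit-function / monotonicity route for μ(n)»).  Located brick for the (C)-closer lane hubbard-kl-c4a-1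
(stub (C) `stub_twoLeg_curvature` of `KLRegimeEngineV17F2`, stmt-HubbardSuperconductivity-20437), memo HOME/hubbard-kl-k3c3-p3/U1-CAUSTIC-SUP.md §10 («what (M4) still
needs»: per ϑ-tile pick the loop windows).  The cover theorem (`…C4aCausticWindowCoverDispatch`) is one call per near-caustic BOX; this file bounds HOW MANY boxes a tile
needs per sheet: one loop arc of torus length `≤ (π/(2u_min))(τ₀ + msD₁L/2)` contains every loop angle that is `τ₀`-near the caustic of the sheet for some `ϑ` in a tile
of length `L` (the caustic point `(S(ϑ) − 2πm)/2` moves at speed `≤ msD₁/2`, and the loop chart is `(2u_min/π)`-bi-Lipschitz on the torus).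
* **`torusDist_loopAngles_le_of_nearCaustic_pair`**: `‖c + Φ(ρ,ϑᵢ+θ) − 2Φ(0,φᵢ+θ)‖ ≤ τ₀` (`i = 1,2`, same base point `c`, `|ρ| < r`) ⟹
  `(2u_min/π)‖φ₁ − φ₂‖_𝕋 ≤ τ₀ + msD₁|ϑ₁ − ϑ₂|/2`;
* **`torusDist_loopAngles_le_of_nearCaustic_tile`**: both `ϑᵢ` in a tile `[α,β]` ⟹ `(2u_min/π)‖φ₁ − φ₂‖_𝕋 ≤ τ₀ + msD₁(β − α)/2`.
(Only the sheets `‖m‖_∞ ≤ 1` are ever active: `…C4aPartnerBandCooperChord.norm_pairSum_sub_twoPi_sub_two_gt`.)  Sizes binder shape; pure geometry on landed rows; nothing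
asserts (C), K3 or superconductivity.
References: BGM 2003 §7.1 Lemma 7.1 [cite: BenfattoGiulianiMastropietro2003]; FST II CPAM 51 (1998) §3 [cite: FeldmanSalmhoferTrubowitz1998].
-/

noncomputable section

namespace Summit.HubbardSuperconductivity.HubbardSuperconductivity.Theorems.C4a

set_option linter.dupNamespace false -- summit = problem name (single-conjunct summit), D-0017

open Real Set
open Literature.MathematicalPhysics.QuantumLattice Literature.MathematicalPhysics.QuantumLattice.BandSectorCounting
open Literature.MathematicalPhysics.QuantumLattice.FermiRG
open Summit.HubbardSuperconductivity.HubbardSuperconductivity.Theorems.KLRegimeSplit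
open Summit.HubbardSuperconductivity.HubbardSuperconductivity.Theorems.DispersionFlow
open Summit.HubbardSuperconductivity.HubbardSuperconductivity.Theorems.PerturbedFermiCurve

section Sizes

variable {K : TrigPolyC4v} {A : ℝ} (hA : ∀ p : Momentum, ∀ j ≤ 2, ‖iteratedFDeriv ℝ j (frameShift K) p‖ ≤ A) (hA20 : A ≤ 1 / 20)
  (hd : klCurveD ≤ (bandBounds (show (-4 : ℝ) < -1.1 by norm_num) (show (-1.1 : ℝ) ≤ -0.1 by norm_num)
    (show (-0.1 : ℝ) < 0 by norm_num)).Dtmin - 2 * A)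
  {μ r : ℝ} (hlo : (-1.1 : ℝ) < μ - r - A) (hhi : μ + r + A < -0.1)
  {A₃ A₄ : ℝ} (hA₃ : ∀ p : Momentum, ‖iteratedFDeriv ℝ 3 (frameShift K) p‖ ≤ A₃)
  (hA₄ : ∀ p : Momentum, ‖iteratedFDeriv ℝ 4 (frameShift K) p‖ ≤ A₄)
include hA hA20 hd hlo hhi hA₃ hA₄

/-- **TWO NEAR-CAUSTIC CONFIGURATIONS OF ONE SHEET HAVE CLOSE LOOP ANGLES.**  `|ρ| < r`, base point `c`, base angle `θ`; if `(ϑ₁,φ₁)` and `(ϑ₂,φ₂)` are both within `τ₀`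
of the caustic, `‖c + Φ(ρ,ϑᵢ+θ) − Φ(0,φᵢ+θ) − Φ(0,φᵢ+θ)‖ ≤ τ₀`, then `(2u_min/π)‖φ₁ − φ₂‖_𝕋 ≤ τ₀ + msD₁|ϑ₁ − ϑ₂|/2`. -/
theorem torusDist_loopAngles_le_of_nearCaustic_pair {ρ : ℝ} (hρ : |ρ| < r) (c : Momentum) (θ : ℝ) {ϑ₁ φ₁ ϑ₂ φ₂ τ₀ : ℝ}
    (h₁ : ‖c + (levelPoint μ K ρ (ϑ₁ + θ) - levelPoint μ K 0 (φ₁ + θ)) - levelPoint μ K 0 (φ₁ + θ)‖ ≤ τ₀)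
    (h₂ : ‖c + (levelPoint μ K ρ (ϑ₂ + θ) - levelPoint μ K 0 (φ₂ + θ)) - levelPoint μ K 0 (φ₂ + θ)‖ ≤ τ₀) :
    2 * (bandBounds (show (-4 : ℝ) < -1.1 by norm_num) (show (-1.1 : ℝ) ≤ -0.1 by norm_num) (show (-0.1 : ℝ) < 0 by norm_num)).umin / π * torusDist (φ₁ - φ₂) ≤ τ₀ + msD A₃ A₄ 1 * |ϑ₁ - ϑ₂| / 2 := by
  set B := bandBounds (show (-4 : ℝ) < -1.1 by norm_num) (show (-1.1 : ℝ) ≤ -0.1 by norm_num) (show (-0.1 : ℝ) < 0 by norm_num) with hBdef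
  have hr' : 0 < r := lt_of_le_of_lt (abs_nonneg ρ) hρ
  have hlo₀ : (-1.1 : ℝ) ≤ μ + 0 - A := by linarith
  have hhi₀ : μ + 0 + A ≤ -0.1 := by linarith
  -- the loop chart is `(2u/π)`-bi-Lipschitz on the torus
  have hch := norm_levelPoint_sub_ge_torusDist B hA hlo₀ hhi₀ hlo₀ hhi₀ (φ₁ + θ) (φ₂ + θ)
  rw [show φ₁ + θ - (φ₂ + θ) = φ₁ - φ₂ by ring] at hch
  -- the caustic point moves at speed `≤ msD₁/2`
  have hq := norm_levelPoint_sub_le_abs hA hA20 hd hlo hhi hA₃ hA₄ hρ (ϑ₁ + θ) (ϑ₂ + θ)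
  rw [show ϑ₁ + θ - (ϑ₂ + θ) = ϑ₁ - ϑ₂ by ring] at hq
  -- `2(p₁ − p₂) = (X₁ − X₂) − (q′₁ − q′₂)`… written as an identity of differences
  have hid : (2 : ℝ) • (levelPoint μ K 0 (φ₁ + θ) - levelPoint μ K 0 (φ₂ + θ)) =
      (levelPoint μ K ρ (ϑ₁ + θ) - levelPoint μ K ρ (ϑ₂ + θ)) -
        ((c + (levelPoint μ K ρ (ϑ₁ + θ) - levelPoint μ K 0 (φ₁ + θ)) - levelPoint μ K 0 (φ₁ + θ)) -
          (c + (levelPoint μ K ρ (ϑ₂ + θ) - levelPoint μ K 0 (φ₂ + θ)) - levelPoint μ K 0 (φ₂ + θ))) := by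
    rw [two_smul]; abel
  have h2n : 2 * ‖levelPoint μ K 0 (φ₁ + θ) - levelPoint μ K 0 (φ₂ + θ)‖ ≤ msD A₃ A₄ 1 * |ϑ₁ - ϑ₂| + (τ₀ + τ₀) := by
    have e : 2 * ‖levelPoint μ K 0 (φ₁ + θ) - levelPoint μ K 0 (φ₂ + θ)‖ = ‖(2 : ℝ) • (levelPoint μ K 0 (φ₁ + θ) - levelPoint μ K 0 (φ₂ + θ))‖ := by
      rw [norm_smul, Real.norm_eq_abs, abs_of_pos (by norm_num : (0 : ℝ) < 2)]
    rw [e, hid]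
    refine (norm_sub_le _ _).trans (add_le_add hq ((norm_sub_le _ _).trans (add_le_add h₁ h₂)))
  linarith

/-- **THE NEAR-CAUSTIC LOCUS OF A TILE IS ONE SHORT LOOP ARC**: both `ϑᵢ` in the tile `[α,β]` ⟹ `(2u_min/π)‖φ₁ − φ₂‖_𝕋 ≤ τ₀ + msD₁(β − α)/2`. -/
theorem torusDist_loopAngles_le_of_nearCaustic_tile {ρ : ℝ} (hρ : |ρ| < r) (c : Momentum) (θ : ℝ) {α β ϑ₁ φ₁ ϑ₂ φ₂ τ₀ : ℝ}
    (hϑ₁ : ϑ₁ ∈ Icc α β) (hϑ₂ : ϑ₂ ∈ Icc α β)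
    (h₁ : ‖c + (levelPoint μ K ρ (ϑ₁ + θ) - levelPoint μ K 0 (φ₁ + θ)) - levelPoint μ K 0 (φ₁ + θ)‖ ≤ τ₀)
    (h₂ : ‖c + (levelPoint μ K ρ (ϑ₂ + θ) - levelPoint μ K 0 (φ₂ + θ)) - levelPoint μ K 0 (φ₂ + θ)‖ ≤ τ₀) :
    2 * (bandBounds (show (-4 : ℝ) < -1.1 by norm_num) (show (-1.1 : ℝ) ≤ -0.1 by norm_num) (show (-0.1 : ℝ) < 0 by norm_num)).umin / π * torusDist (φ₁ - φ₂) ≤ τ₀ + msD A₃ A₄ 1 * (β - α) / 2 := by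
  have h := torusDist_loopAngles_le_of_nearCaustic_pair hA hA20 hd hlo hhi hA₃ hA₄ hρ c θ h₁ h₂
  have hM : 0 ≤ msD A₃ A₄ 1 := (norm_nonneg _).trans (norm_iteratedDeriv_levelPoint_le hA hA20 hd hlo hhi hA₃ hA₄ hρ le_rfl (by norm_num) 0)
  have h1 : |ϑ₁ - ϑ₂| ≤ β - α := abs_sub_le_iff.2 ⟨by linarith [hϑ₁.2, hϑ₂.1], by linarith [hϑ₁.1, hϑ₂.2]⟩
  have := mul_le_mul_of_nonneg_left h1 hM
  linarith

end Sizes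

end Summit.HubbardSuperconductivity.HubbardSuperconductivity.Theorems.C4a

end
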